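import Literature.NumberTheory.LFunctions.WeilGroundStateRealZeros
import HarnessLib

/-!
# Route WeilGroundState — crux `GroundStateSimpleEven` (stmt-RiemannHypothesis-1526), transfer step

Support file for line `Sketch` of the crux `∀ a > 0, WeilWindowSimpleEven a`: the TRANSFER step
`stub_weilWindowSimpleEven_of_meanZeroGap`. The window clause
`Literature.NumberTheory.LFunctions.WeilWindowSimpleEven a` (file
`Literature/NumberTheory/LFunctions/WeilGroundStateRealZeros.lean`) asks for a witness `φ` and a gap
`δ > 0` such that every `L²`-normalised test function on `[-a, a]` which is odd, or even and
`L²`-orthogonal to `φ`, has `Re Q(g) ≥ ε(a) + δ` (`ε(a) = weilGroundEnergy a`,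
`Q = weilQuadratic`). With the witness `φ = 1` both kinds of test functions are MEAN-ZERO: an odd
`g` has `∫ g = ∫ g(-·) = -∫ g` (`MeasureTheory.integral_neg_eq_self`, `MeasureTheory.integral_neg`),
and `∫ conj 1 · g = ∫ g`. Hence a gap for mean-zero normalised test functions on the window gives the
clause. (Same argument as the in-tree `Literature.NumberTheory.LFunctions.Suzuki2026_thm_1_4_holds`,
file `Literature/NumberTheory/LFunctions/WeilWindowSuzukiProofs.lean`, with the gap abstracted.)

Mathlib only beyond the definition of the clause.
-/

noncomputable section

open Set MeasureTheory
open scoped ComplexConjugate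

namespace Summit.RiemannHypothesis.RiemannHypothesis.Theorems

open Literature.NumberTheory.LFunctions

set_option linter.dupNamespace false in
/-- An odd function `g : ℝ → ℂ` has `∫ g = 0`: `∫ g = ∫ g(-·)` (Lebesgue measure is invariant under
`t ↦ -t`) and `∫ g(-·) = ∫ (-g) = -∫ g`. No integrability hypothesis is needed (both sides are the
junk value `0` otherwise). [folklore] -/
theorem integral_eq_zero_of_odd {g : ℝ → ℂ} (hodd : ∀ t, g (-t) = -g t) : ∫ t, g t = 0 := by
  have h1 : ∫ t : ℝ, g (-t) = ∫ t : ℝ, g t := integral_neg_eq_self g volume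
  have h2 : ∫ t : ℝ, g (-t) = -∫ t : ℝ, g t := by
    simp_rw [hodd]
    exact integral_neg g
  have h3 : ∫ t : ℝ, g t = -∫ t : ℝ, g t := h1.symm.trans h2
  linear_combination h3 / 2

set_option linter.dupNamespace false in
/-- **Transfer (witness `φ = 1`).** A gap `δ > 0` for MEAN-ZERO `L²`-normalised test functions on the
window `[-a, a]` gives the window clause `WeilWindowSimpleEven a` with witness `φ = 1`: an odd test
function has `∫ g = 0` (`integral_eq_zero_of_odd`), and an even one with `∫ conj 1 · g = 0` has
`∫ g = 0`, so `hgap` applies in both branches of the parity hypothesis. [folklore] -/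
theorem stub_weilWindowSimpleEven_of_meanZeroGap (a δ : ℝ) (hδ : 0 < δ)
    (hgap : ∀ g : ℝ → ℂ, IsWeilTest g → tsupport g ⊆ Icc (-a) a →
      ∫ t, ‖g t‖ ^ 2 = (1 : ℝ) → ∫ t, g t = 0 → weilGroundEnergy a + δ ≤ (weilQuadratic g).re) :
    WeilWindowSimpleEven a := by
  refine ⟨fun _ ↦ 1, δ, hδ, fun g hg hsupp hnorm hpar ↦ ?_⟩
  have hmean : ∫ t : ℝ, g t = 0 := by
    rcases hpar with hodd | ⟨-, horth⟩
    · exact integral_eq_zero_of_odd hodd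
    · simpa using horth
  exact hgap g hg hsupp hnorm hmean

end Summit.RiemannHypothesis.RiemannHypothesis.Theorems

end
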